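import Summits.CriticalPhenomena.PercolationContinuityZ3.Theorems.PercNearOneGluingNoHeavyLowerTailCILTwoSteinerSeries
import HarnessLib

/-!
# `NoHeavyLowerTail` (stmt-CriticalPhenomena-4575) — CIL at EVERY observer when the Steiner skeleton has maximum degree two
# (non-relay vertices form paths and cycles, with arbitrary relay hairs), every level, every champion

Support file (prover `prim-hp-2`, deletion–contraction / pivotal-edge line; `--supports stmt-CriticalPhenomena-4575`).
No definitions, no named facts, no sorries.  Notation as in `…CILTwoSteinerSeries.lean`.

THE CLASS.  Every non-relay vertex has at most two positive-weight NON-RELAY neighbours (its relay neighbours — "hairs" — and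
the pairs among relays are unrestricted).  Equivalently the positive pairs among non-relays form a disjoint union of paths and
cycles.  It contains the relay-neighboured observers (`cil_champion_of_relayNeighbours`), the one-Steiner observers
(`cil_oneSteiner`), the Steiner paths observed from an END (`cil_steinerPath`, prim-gen-swap), the two pendant relay-stars
(`cil_twoSteiner`, `cil_twoSteiner_adj`), and newly: Steiner paths observed from ANY vertex and Steiner cycles through the
observer, all with arbitrary relay hairs.

* `SteinerSkeleton.cil_of_componentDegLeTwo` (relative to a closed vertex set `C ∋ o`: only the Steiner component of `o` is
  constrained) and `SteinerSkeleton.cil_of_skeletonDegLeTwo` (`C` = everything) — for every champion `c` of `w`: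
  `μ(1 ≤ |π(o)| ≤ j) ≤ μ(|π(c)| ≤ j)`, at every level `j`.
  Proof: strong induction on the number of non-relay vertices carrying a positive pair.  If `o` has no non-relay neighbour:
  `cil_champion_of_relayNeighbours`.  One non-relay neighbour `x`: the modular one-Steiner step `cil_oneSteiner_of`, whose
  hypothesis (CIL at `x` in `G − o`) is the induction hypothesis (`G − o` is in the class and `o` no longer carries a pair).  Two
  non-relay neighbours `x ≠ y`: the modular observer series law `cil_twoSteiner_of`, whose hypotheses (CIL at `x` and at `y` in the
  series-reduced graph `w₃ = (G − o) + xy`) are the induction hypothesis (`w₃` is in the class: `x`, `y` trade the neighbour `o` for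
  each other).
* `SteinerSkeleton.cil_of_componentDegLeTwo_exists` — the `∃ a ∈ A` shape of the registered `stub_cumulativeIsolation` for this class.
-/

noncomputable section

namespace Summit.CriticalPhenomena.PercolationContinuityZ3.Theorems

open MeasureTheory Set Literature.Probability.LatticeModels Literature.Probability.Percolation
open scoped Classical BigOperators

variable {n : ℕ}

namespace SteinerSkeleton

open CILOneSteiner ChampionStability MergeStability RelayNbhd CILTwoSteiner

/-- A positive pinned weight (pairs at `o` closed) is a positive weight. [folklore] -/
theorem ne_zero_of_pinW_ne_zero (w : Sym2 (Fin n) → unitInterval) (o : Fin n) {e : Sym2 (Fin n)}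
    (h : pinW w {e : Sym2 (Fin n) | o ∈ e ∧ ¬ e.IsDiag} ∅ e ≠ 0) : w e ≠ 0 := by
  by_cases hmem : e ∈ {e : Sym2 (Fin n) | o ∈ e ∧ ¬ e.IsDiag}
  · exact absurd (pinW_apply_of_mem_of_not_mem w hmem (Set.notMem_empty _)) h
  · rwa [pinW_apply_of_not_mem w ∅ hmem] at h

/-- The induction measure (number of non-relays carrying a positive pair) drops when `o` loses all its pairs and no vertex
gains one. [folklore] -/
theorem measure_lt (w w' : Sym2 (Fin n) → unitInterval) (A : Finset (Fin n)) (o : Fin n) (ho : o ∉ A)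
    (hpair : ∃ u : Fin n, u ≠ o ∧ w s(o, u) ≠ 0) (hiso : ∀ u : Fin n, u ≠ o → w' s(o, u) = 0)
    (hsub : ∀ v : Fin n, v ∉ A → v ≠ o → ∀ u : Fin n, u ≠ v → w' s(v, u) ≠ 0 → ∃ u' : Fin n, u' ≠ v ∧ w s(v, u') ≠ 0) :
    (Finset.univ.filter fun v : Fin n => v ∉ A ∧ ∃ u : Fin n, u ≠ v ∧ w' s(v, u) ≠ 0).card <
      (Finset.univ.filter fun v : Fin n => v ∉ A ∧ ∃ u : Fin n, u ≠ v ∧ w s(v, u) ≠ 0).card := by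
  apply Finset.card_lt_card
  rw [Finset.ssubset_iff_of_subset]
  · refine ⟨o, Finset.mem_filter.2 ⟨Finset.mem_univ _, ho, hpair⟩, fun h => ?_⟩
    obtain ⟨-, -, u, hu, hne⟩ := Finset.mem_filter.1 h
    exact hne (hiso u hu)
  · intro v hv
    obtain ⟨-, hvA, u, hu, hne⟩ := Finset.mem_filter.1 hv
    have hvo : v ≠ o := by
      rintro rfl
      exact hne (hiso u hu)
    exact Finset.mem_filter.2 ⟨Finset.mem_univ _, hvA, hsub v hvA hvo u hu hne⟩

/-- **CIL (every level, every champion) at every observer when each non-relay vertex has at most two non-relay positive-weight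
neighbours** — measure-bounded form for the induction. -/
theorem cil_of_skeletonDegLeTwo_aux (A C : Finset (Fin n)) (j : ℕ) :
    ∀ (m : ℕ) (w : Sym2 (Fin n) → unitInterval),
      (Finset.univ.filter fun v : Fin n => v ∉ A ∧ ∃ u : Fin n, u ≠ v ∧ w s(v, u) ≠ 0).card ≤ m →
      (∀ v ∈ C, v ∉ A → ∀ u : Fin n, u ≠ v → u ∉ A → w s(v, u) ≠ 0 → u ∈ C) →
      (∀ v ∈ C, v ∉ A → ∃ x y : Fin n, ∀ u : Fin n, u ≠ v → u ∉ A → w s(v, u) ≠ 0 → u = x ∨ u = y) →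
      ∀ o ∈ C, o ∉ A → ∀ c ∈ A, (∀ a ∈ A,
        (prodBernoulli w).real {ω : BondConfig (Fin n) | (A.filter fun z => ω ∈ openConn a z).card ≤ j} ≤
          (prodBernoulli w).real {ω : BondConfig (Fin n) | (A.filter fun z => ω ∈ openConn c z).card ≤ j}) →
      (prodBernoulli w).real {ω : BondConfig (Fin n) |
          1 ≤ (A.filter fun z => ω ∈ openConn o z).card ∧ (A.filter fun z => ω ∈ openConn o z).card ≤ j} ≤
        (prodBernoulli w).real {ω : BondConfig (Fin n) | (A.filter fun z => ω ∈ openConn c z).card ≤ j} := by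
  intro m
  induction m with
  | zero =>
    intro w hm _ _ o _ ho c _ _
    -- `o` carries no positive pair
    have hiso : ∀ v : Fin n, v ≠ o → (w s(o, v) : ℝ) = 0 := by
      intro v hv
      by_contra hne
      have hne' : w s(o, v) ≠ 0 := fun h => hne (by rw [h]; rfl)
      have hmem : o ∈ (Finset.univ.filter fun v : Fin n => v ∉ A ∧ ∃ u : Fin n, u ≠ v ∧ w s(v, u) ≠ 0) :=
        Finset.mem_filter.2 ⟨Finset.mem_univ _, ho, v, hv, hne'⟩
      have := Finset.card_pos.2 ⟨o, hmem⟩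
      omega
    rw [real_L_eq_zero_of_isolated w A o j ho hiso]
    exact measureReal_nonneg
  | succ m ih =>
    intro w hm hC hdeg o hoC ho c hc hchamp
    -- relay-neighboured observer
    by_cases hrel : ∀ v : Fin n, v ≠ o → v ∉ A → (w s(o, v) : ℝ) = 0
    · exact cil_champion_of_relayNeighbours A o j ho _ w rfl hrel c hc hchamp
    push Not at hrel
    obtain ⟨x, hxo, hx, hx0⟩ := hrel
    have hx0' : w s(o, x) ≠ 0 := fun h => hx0 (by rw [h]; rfl)
    have hpair : ∃ u : Fin n, u ≠ o ∧ w s(o, u) ≠ 0 := ⟨x, hxo, hx0'⟩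
    obtain ⟨a, b, hab⟩ := hdeg o hoC ho
    have hxC : x ∈ C := hC o hoC ho x hxo hx hx0'
    by_cases hone : ∀ v : Fin n, v ≠ o → v ∉ A → v ≠ x → (w s(o, v) : ℝ) = 0
    · -- ONE non-relay neighbour: the modular one-Steiner step, hypothesis from the induction hypothesis in `G − o`
      set w0 : Sym2 (Fin n) → unitInterval := pinW w {e : Sym2 (Fin n) | o ∈ e ∧ ¬ e.IsDiag} ∅ with hw0
      have hm0 : (Finset.univ.filter fun v : Fin n => v ∉ A ∧ ∃ u : Fin n, u ≠ v ∧ w0 s(v, u) ≠ 0).card ≤ m := by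
        have hlt := measure_lt w w0 A o ho hpair (fun u hu => by rw [hw0]; exact pinW_star_mk w hu)
          (fun v _ _ u hu hne => ⟨u, hu, ne_zero_of_pinW_ne_zero w o (by rw [hw0] at hne; exact hne)⟩)
        omega
      have hC0 : ∀ v ∈ C, v ∉ A → ∀ u : Fin n, u ≠ v → u ∉ A → w0 s(v, u) ≠ 0 → u ∈ C :=
        fun v hvC hvA u hu huA hne => hC v hvC hvA u hu huA (ne_zero_of_pinW_ne_zero w o (by rw [hw0] at hne; exact hne))
      have hdeg0 : ∀ v ∈ C, v ∉ A → ∃ x y : Fin n, ∀ u : Fin n, u ≠ v → u ∉ A → w0 s(v, u) ≠ 0 → u = x ∨ u = y := by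
        intro v hvC hvA
        obtain ⟨x', y', h'⟩ := hdeg v hvC hvA
        exact ⟨x', y', fun u hu huA hne => h' u hu huA (ne_zero_of_pinW_ne_zero w o (by rw [hw0] at hne; exact hne))⟩
      refine cil_oneSteiner_of A o x j ho hx hxo _ w rfl hone ?_ c hc hchamp
      intro c' hc' hchamp'
      rw [← hw0] at hchamp' ⊢
      exact ih w0 hm0 hC0 hdeg0 x hxC hx c' hc' hchamp'
    · -- TWO non-relay neighbours `x ≠ y`: the modular observer series law, hypotheses from the induction hypothesis in `w₃`
      push Not at hone
      obtain ⟨y, hyo, hy, hyx, hy0⟩ := hone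
      have hy0' : w s(o, y) ≠ 0 := fun h => hy0 (by rw [h]; rfl)
      have hyC : y ∈ C := hC o hoC ho y hyo hy hy0'
      have hxy : x ≠ y := fun h => hyx h.symm
      have hox : o ≠ x := fun h => hxo h.symm
      have hoy : o ≠ y := fun h => hyo h.symm
      -- every non-relay neighbour of `o` is `x` or `y`
      have hxab : x = a ∨ x = b := hab x hxo hx hx0'
      have hyab : y = a ∨ y = b := hab y hyo hy hy0'
      have hoN : ∀ v : Fin n, v ≠ o → v ∉ A → v ≠ x → v ≠ y → (w s(o, v) : ℝ) = 0 := by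
        intro v hvo hvA hvx hvy
        by_contra hne
        have hne' : w s(o, v) ≠ 0 := fun h => hne (by rw [h]; rfl)
        rcases hab v hvo hvA hne' with rfl | rfl
        · rcases hxab with h | h
          · exact hvx h.symm
          · rcases hyab with h' | h'
            · exact hvy h'.symm
            · exact hxy (h.trans h'.symm)
        · rcases hxab with h | h
          · rcases hyab with h' | h'
            · exact hxy (h.trans h'.symm)
            · exact hvy h'.symm
          · exact hvx h.symm
      -- the series-reduced graph, written out
      set w₃ : Sym2 (Fin n) → unitInterval := Function.update (pinW w {e : Sym2 (Fin n) | o ∈ e ∧ ¬ e.IsDiag} ∅) s(x, y)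
        ⟨1 - (1 - (w s(x, y) : ℝ)) * (1 - (w s(o, x) : ℝ) * w s(o, y)), HullPort.seriesWeight_mem w o x y⟩ with hw₃
      have hg_o : o ∉ s(x, y) := by
        rw [Sym2.mem_iff, not_or]; exact ⟨hox, hoy⟩
      have h₃z : ∀ v : Fin n, v ≠ o → w₃ s(o, v) = 0 := by
        intro v hv
        have hne : s(o, v) ≠ s(x, y) := fun h => hg_o (h ▸ Sym2.mem_mk_left o v)
        rw [hw₃, Function.update_of_ne hne]
        exact pinW_star_mk w hv
      have h₃zz : w₃ s(o, o) = w s(o, o) := by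
        have hne : s(o, o) ≠ s(x, y) := fun h => hg_o (h ▸ Sym2.mem_mk_left o o)
        have hdiag : s(o, o) ∉ {e : Sym2 (Fin n) | o ∈ e ∧ ¬ e.IsDiag} := by
          rintro ⟨-, h⟩; exact h (Sym2.mk_isDiag_iff.2 rfl)
        rw [hw₃, Function.update_of_ne hne, pinW_apply_of_not_mem w ∅ hdiag]
      have h₃off : ∀ e : Sym2 (Fin n), o ∉ e → e ≠ s(x, y) → w₃ e = w e := by
        intro e hoe hne
        have hmem : e ∉ {e : Sym2 (Fin n) | o ∈ e ∧ ¬ e.IsDiag} := fun h => hoe h.1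
        rw [hw₃, Function.update_of_ne hne, pinW_apply_of_not_mem w ∅ hmem]
      have h₃xy : (w₃ s(x, y) : ℝ) = 1 - (1 - (w s(x, y) : ℝ)) * (1 - (w s(o, x) : ℝ) * w s(o, y)) := by
        rw [hw₃, Function.update_self]
      -- positive pairs of `w₃` away from `s(x,y)` are positive pairs of `w` not at `o`
      have h₃pos : ∀ v u : Fin n, v ≠ o → u ≠ v → w₃ s(v, u) ≠ 0 → u ≠ o ∧ (s(v, u) = s(x, y) ∨ w s(v, u) ≠ 0) := by
        intro v u hvo huv hne
        have huo : u ≠ o := by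
          rintro rfl
          rw [Sym2.eq_swap] at hne
          exact hne (h₃z v hvo)
        refine ⟨huo, ?_⟩
        by_cases hg : s(v, u) = s(x, y)
        · exact Or.inl hg
        · right
          have hoe : o ∉ s(v, u) := by
            rw [Sym2.mem_iff, not_or]; exact ⟨fun h => hvo h.symm, fun h => huo h.symm⟩
          rwa [h₃off _ hoe hg] at hne
      have hm3 : (Finset.univ.filter fun v : Fin n => v ∉ A ∧ ∃ u : Fin n, u ≠ v ∧ w₃ s(v, u) ≠ 0).card ≤ m := by
        have hlt := measure_lt w w₃ A o ho hpair h₃z (fun v _ hvo u hu hne => by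
          obtain ⟨-, h⟩ := h₃pos v u hvo hu hne
          rcases h with hg | h
          · -- `v ∈ {x, y}`: it has the pair to `o` in `w`
            have hv : v = x ∨ v = y := by
              have : v ∈ s(x, y) := by rw [← hg]; exact Sym2.mem_mk_left v u
              exact Sym2.mem_iff.1 this
            rcases hv with rfl | rfl
            · exact ⟨o, hox, by rw [Sym2.eq_swap]; exact hx0'⟩
            · exact ⟨o, hoy, by rw [Sym2.eq_swap]; exact hy0'⟩
          · exact ⟨u, hu, h⟩)
        omega
      -- `w₃` is in the class (relative to `C`)
      have hC3 : ∀ v ∈ C, v ∉ A → ∀ u : Fin n, u ≠ v → u ∉ A → w₃ s(v, u) ≠ 0 → u ∈ C := by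
        intro v hvC hvA u hu huA hne
        by_cases hvo : v = o
        · subst hvo; exact absurd (h₃z u hu) hne
        obtain ⟨-, h⟩ := h₃pos v u hvo hu hne
        rcases h with hg | h
        · have : u ∈ s(x, y) := by rw [← hg]; exact Sym2.mem_mk_right v u
          rcases Sym2.mem_iff.1 this with h1 | h1
          · exact h1 ▸ hxC
          · exact h1 ▸ hyC
        · exact hC v hvC hvA u hu huA h
      have hdeg3 : ∀ v ∈ C, v ∉ A → ∃ x' y' : Fin n, ∀ u : Fin n, u ≠ v → u ∉ A → w₃ s(v, u) ≠ 0 → u = x' ∨ u = y' := by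
        intro v hvC hvA
        by_cases hvo : v = o
        · subst hvo
          exact ⟨v, v, fun u hu _ hne => absurd (h₃z u hu) hne⟩
        -- the old witnesses for `v`, with `o` replaced by the new neighbour when `v ∈ {x, y}`
        obtain ⟨a', b', h'⟩ := hdeg v hvC hvA
        by_cases hvx : v = x
        · subst hvx
          -- `o` is one of `a', b'`; the other one and `y` are the witnesses
          have hoab : o = a' ∨ o = b' := h' o (Ne.symm hvo) ho (by rw [Sym2.eq_swap]; exact hx0')
          have key : ∀ u : Fin n, u ≠ v → u ∉ A → w₃ s(v, u) ≠ 0 → u ≠ o ∧ (u = y ∨ u = a' ∨ u = b') := by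
            intro u hu huA hne
            obtain ⟨huo, h⟩ := h₃pos v u hvo hu hne
            refine ⟨huo, ?_⟩
            rcases h with hg | h
            · exact Or.inl (Sym2.congr_right.1 hg)
            · exact Or.inr (h' u hu huA h)
          rcases hoab with hoa | hob
          · refine ⟨b', y, fun u hu huA hne => ?_⟩
            obtain ⟨huo, h⟩ := key u hu huA hne
            rcases h with h | h | h
            · exact Or.inr h
            · exact absurd (h.trans hoa.symm) huo
            · exact Or.inl h
          · refine ⟨a', y, fun u hu huA hne => ?_⟩
            obtain ⟨huo, h⟩ := key u hu huA hne
            rcases h with h | h | h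
            · exact Or.inr h
            · exact Or.inl h
            · exact absurd (h.trans hob.symm) huo
        by_cases hvy : v = y
        · subst hvy
          have hoab : o = a' ∨ o = b' := h' o (Ne.symm hvo) ho (by rw [Sym2.eq_swap]; exact hy0')
          have key : ∀ u : Fin n, u ≠ v → u ∉ A → w₃ s(v, u) ≠ 0 → u ≠ o ∧ (u = x ∨ u = a' ∨ u = b') := by
            intro u hu huA hne
            obtain ⟨huo, h⟩ := h₃pos v u hvo hu hne
            refine ⟨huo, ?_⟩
            rcases h with hg | h
            · left
              have : u ∈ s(x, v) := by rw [← hg]; exact Sym2.mem_mk_right v u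
              rcases Sym2.mem_iff.1 this with h1 | h1
              · exact h1
              · exact absurd h1 hu
            · exact Or.inr (h' u hu huA h)
          rcases hoab with hoa | hob
          · refine ⟨b', x, fun u hu huA hne => ?_⟩
            obtain ⟨huo, h⟩ := key u hu huA hne
            rcases h with h | h | h
            · exact Or.inr h
            · exact absurd (h.trans hoa.symm) huo
            · exact Or.inl h
          · refine ⟨a', x, fun u hu huA hne => ?_⟩
            obtain ⟨huo, h⟩ := key u hu huA hne
            rcases h with h | h | h
            · exact Or.inr h
            · exact Or.inl h
            · exact absurd (h.trans hob.symm) huo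
        · refine ⟨a', b', fun u hu huA hne => ?_⟩
          obtain ⟨huo, h⟩ := h₃pos v u hvo hu hne
          rcases h with hg | h
          · exfalso
            have : v ∈ s(x, y) := by rw [← hg]; exact Sym2.mem_mk_left v u
            rcases Sym2.mem_iff.1 this with h1 | h1
            · exact hvx h1
            · exact hvy h1
          · exact h' u hu huA h
      refine cil_twoSteiner_of A o x y j ho hx hy hxo hyo hxy w₃ h₃z ?_ ?_ _ w rfl hoN h₃zz h₃off h₃xy c hc hchamp
      · intro c' hc' hchamp'
        exact ih w₃ hm3 hC3 hdeg3 x hxC hx c' hc' hchamp'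
      · intro c' hc' hchamp'
        exact ih w₃ hm3 hC3 hdeg3 y hyC hy c' hc' hchamp'

/-- **CIL at every observer of a Steiner component of maximum degree two** (every level, every champion).  Let `C` be a set
of vertices containing the observer `o ∉ A` and closed under positive-weight pairs between non-relays (every non-relay
positive-weight neighbour of a non-relay member is a member), such that every non-relay member has at most two non-relay
positive-weight neighbours — i.e. the Steiner component of `o` is a path or a cycle dressed with arbitrary relay hairs; the rest
of the graph (relays, other Steiner components) is unrestricted.  Then `μ(1 ≤ |π(o)| ≤ j) ≤ μ(|π(c)| ≤ j)` for every champion `c` of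
`w`.  Contains `cil_oneSteiner`, `cil_steinerPath` (observer at an end), `cil_twoSteiner`, `cil_twoSteiner_adj`; new: observer
anywhere on a Steiner path, Steiner cycles through the observer.
[cite: KozmaNitzan2024, Thm 5 (p. 13) and its "simple generalisations" — CIL analogue; VandenbergHaggstromKahn2005, Thm. 1.5] -/
theorem cil_of_componentDegLeTwo (w : Sym2 (Fin n) → unitInterval) (A C : Finset (Fin n)) (o : Fin n) (j : ℕ)
    (hoC : o ∈ C) (ho : o ∉ A)
    (hC : ∀ v ∈ C, v ∉ A → ∀ u : Fin n, u ≠ v → u ∉ A → w s(v, u) ≠ 0 → u ∈ C)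
    (hdeg : ∀ v ∈ C, v ∉ A → ∃ x y : Fin n, ∀ u : Fin n, u ≠ v → u ∉ A → w s(v, u) ≠ 0 → u = x ∨ u = y)
    (c : Fin n) (hc : c ∈ A)
    (hchamp : ∀ a ∈ A,
      (prodBernoulli w).real {ω : BondConfig (Fin n) | (A.filter fun z => ω ∈ openConn a z).card ≤ j} ≤
        (prodBernoulli w).real {ω : BondConfig (Fin n) | (A.filter fun z => ω ∈ openConn c z).card ≤ j}) :
    (prodBernoulli w).real {ω : BondConfig (Fin n) |
        1 ≤ (A.filter fun z => ω ∈ openConn o z).card ∧ (A.filter fun z => ω ∈ openConn o z).card ≤ j} ≤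
      (prodBernoulli w).real {ω : BondConfig (Fin n) | (A.filter fun z => ω ∈ openConn c z).card ≤ j} :=
  cil_of_skeletonDegLeTwo_aux A C j _ w le_rfl hC hdeg o hoC ho c hc hchamp

/-- **CIL at every observer when the whole Steiner skeleton has maximum degree two** (every level, every champion): if every
non-relay vertex has at most two positive-weight non-relay neighbours (relay neighbours and relay–relay pairs unrestricted:
the non-relays form paths and cycles dressed with relay hairs), then for every observer `o ∉ A` and every champion `c` of `w`,
`μ(1 ≤ |π(o)| ≤ j) ≤ μ(|π(c)| ≤ j)`.  (`cil_of_componentDegLeTwo` with `C` = all vertices.) -/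
theorem cil_of_skeletonDegLeTwo (w : Sym2 (Fin n) → unitInterval) (A : Finset (Fin n)) (o : Fin n) (j : ℕ) (ho : o ∉ A)
    (hdeg : ∀ v : Fin n, v ∉ A → ∃ x y : Fin n, ∀ u : Fin n, u ≠ v → u ∉ A → w s(v, u) ≠ 0 → u = x ∨ u = y)
    (c : Fin n) (hc : c ∈ A)
    (hchamp : ∀ a ∈ A,
      (prodBernoulli w).real {ω : BondConfig (Fin n) | (A.filter fun z => ω ∈ openConn a z).card ≤ j} ≤
        (prodBernoulli w).real {ω : BondConfig (Fin n) | (A.filter fun z => ω ∈ openConn c z).card ≤ j}) :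
    (prodBernoulli w).real {ω : BondConfig (Fin n) |
        1 ≤ (A.filter fun z => ω ∈ openConn o z).card ∧ (A.filter fun z => ω ∈ openConn o z).card ≤ j} ≤
      (prodBernoulli w).real {ω : BondConfig (Fin n) | (A.filter fun z => ω ∈ openConn c z).card ≤ j} :=
  cil_of_componentDegLeTwo w A Finset.univ o j (Finset.mem_univ _) ho (fun _ _ _ u _ _ _ => Finset.mem_univ u)
    (fun v _ hvA => hdeg v hvA) c hc hchamp

/-- **The same in the shape of the registered `stub_cumulativeIsolation`** (`∃ a ∈ A`, `A` nonempty; component form). -/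
theorem cil_of_componentDegLeTwo_exists (w : Sym2 (Fin n) → unitInterval) (A C : Finset (Fin n)) (o : Fin n) (j : ℕ)
    (hA : A.Nonempty) (hoC : o ∈ C) (ho : o ∉ A)
    (hC : ∀ v ∈ C, v ∉ A → ∀ u : Fin n, u ≠ v → u ∉ A → w s(v, u) ≠ 0 → u ∈ C)
    (hdeg : ∀ v ∈ C, v ∉ A → ∃ x y : Fin n, ∀ u : Fin n, u ≠ v → u ∉ A → w s(v, u) ≠ 0 → u = x ∨ u = y) :
    ∃ a ∈ A, (prodBernoulli w).real {ω : BondConfig (Fin n) |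
        1 ≤ (A.filter fun z => ω ∈ openConn o z).card ∧ (A.filter fun z => ω ∈ openConn o z).card ≤ j} ≤
      (prodBernoulli w).real {ω : BondConfig (Fin n) | (A.filter fun z => ω ∈ openConn a z).card ≤ j} := by
  obtain ⟨c, hc, hchamp⟩ := exists_champion (prodBernoulli w) A hA j
  exact ⟨c, hc, cil_of_componentDegLeTwo w A C o j hoC ho hC hdeg c hc hchamp⟩

end SteinerSkeleton

end Summit.CriticalPhenomena.PercolationContinuityZ3.Theorems

end
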